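import Literature.NumberTheory.Transcendental.DiazMainIIProofs
import Literature.NumberTheory.Transcendental.ExpSmallTrdegProofs
import HarnessLib

/-!
# Diaz 1989, Théorème 1 (`Diaz1989_thm1`): the range `[(mn+m)/(m+n)] ≤ 2` holds unconditionally — proofs only

Topic `Literature/NumberTheory/Transcendental`. Proofs-only sibling of `DiazMain.lean` for the
named fact `Literature.NumberTheory.Transcendental.Diaz1989_thm1` — G. Diaz, *Grands degrés de
transcendance pour des familles d'exponentielles*, J. Number Theory 31 (1989) 1–23, Théorème 1
(pp. 1–2): for `ℚ`-linearly independent families `u₁, …, u_n` (`n ≥ 1`) and `v₁, …, v_m`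
(`m ≥ 2`) satisfying the technical hypothesis (HT1),
`trdeg_ℚ ℚ(v_k, e^{u_hv_k}) ≥ [(mn+m)/(m+n)]`. No definition and no named fact is introduced
here; nothing is asserted. What this file PROVES:

* `Diaz1989_thm1_smallRange` — the conclusion of Théorème 1 whenever `[(mn+m)/(m+n)] ≤ 1`
  (i.e. `mn + m < 2(m+n)`: `m = 2`, or `n = 1`, or `(m, n) = (3, 2)`), for ALL `ℚ`-linearly
  independent `u` (`n ≥ 1`), `v` (`m ≥ 2`), with no measure of linear independence: this is the
  Gelfond–Schneider theorem (Laurent 1991, p. 212: "le théorème bien connu de GEL'FOND-SCHNEIDER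
  sur la transcendance de `a^b` équivaut quant à lui à `t₂ ≥ 1`, pour `m = 2, n = 1`"), in the
  tree `DiazMain.one_le_trdeg_adjoin` (`DiazMainIIProofs.lean`, from `gelfond_schneider_holds`);
* `Diaz1989_thm1_midRange` — the conclusion of Théorème 1 whenever `[(mn+m)/(m+n)] ≤ 2`
  (i.e. `mn + m < 3(m+n)`), again for all `ℚ`-linearly independent `u`, `v` and with no measure
  of linear independence (Laurent 1991, Remarque 3, p. 214: "On peut probablement s'affranchir de
  toute hypothèse de mesure d'indépendance linéaire dans l'énoncé du théorème 3. Il en est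
  notamment ainsi en degré de transcendance 0 ou 1 (i.e. `t_k ≥ 1` ou `2`)"): the bound `2` is
  reached exactly when `m + 2n ≤ mn`, which is the hypothesis `mn ≥ 2m + n` (rôles of `m`, `n`
  exchanged) of LNM 1752, Ch. 13, Theorem 3.1 (ii) — `trdeg ℚ(yⱼ, e^{xᵢyⱼ}) ≥ 2`, PROVED in the
  tree (`Laurent2001_thm_3_1_ii_holds`, `ExpSmallTrdegProofs.lean`: Schneider's method, Tijdeman's
  zero estimate, Gel'fond's criterion) — applied with `(x, y) = (u, v)`, whose field `K₂` is
  Diaz's `ℚ(v_k, e^{u_hv_k})` on the nose (`gridFieldY u v`);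
* `Diaz1989_thm1_of_range_three_le`, `Diaz1989_thm1_iff_range_three_le` — hence the named fact
  `Diaz1989_thm1` is EQUIVALENT to its restriction to the range `3(m+n) ≤ mn + m`
  (`[(mn+m)/(m+n)] ≥ 3`), the only range where Diaz's method (Philippon's criterion for
  algebraic independence, `Diaz1989_thm1_of_mainCriterion`, `DiazZeroLemmaHolds.lean`; or LNM 1752
  Ch. 8 Cor. 1.1, `Diaz1989_thm1_of_ch8_cor_1_1`, `DiazCor1Proofs.lean`) is still needed, and
  `Diaz1989_thm1.largeRange_bounds` — in that range `n ≥ 3` and `m ≥ 4`.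

Dictionary (cf. the module docstring of `DiazMain.lean`): Laurent's `xᵢ` (`m` of them, adjoined
in `t₂`) are Diaz's `v_k`; Laurent's `yⱼ` (`n` of them) are Diaz's `u_h`; Laurent's Théorème 3 ii)
(p. 213: "si `m ≥ 2`, `t₂ ≥ [(mn+m)/(m+n)]`", "extrait de [9]" = Diaz 1989) is the transcription
of Diaz's Théorème 1 vendored separately as `Diaz1989_main_ii` (whose own small range is treated
in `DiazMainIIProofs.lean`; the present file does the same for Diaz's statement itself, whose
hypotheses (HT1) differ from Laurent's measures — see `DiazMainIIProofs.lean`, "Why this is not a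
corollary").

## References

* [Diaz1989] G. Diaz, *Grands degrés de transcendance pour des familles d'exponentielles*,
  J. Number Theory 31 (1989) 1–23, Théorème 1 (pp. 1–2).
* [Laurent1991] M. Laurent, *Sur quelques résultats récents de transcendance*, Journées
  Arithmétiques de Luminy 1989, Astérisque 198–200 (1991) 209–230, §3.1: p. 212 (Gelfond–Schneider
  ⟺ `t₂ ≥ 1` for `m = 2, n = 1`), Théorème 3 ii) (p. 213), Remarque 3 (p. 214).
* [NesterenkoPhilippon2001] Yu. V. Nesterenko, P. Philippon (eds.), *Introduction to Algebraic
  Independence Theory*, LNM 1752 (2001), Ch. 13 (M. Laurent), Theorem 3.1 (ii) (book p. 221,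
  PDF p. 233).
* A. O. Gelfond (1934), Th. Schneider (1934): the Gelfond–Schneider theorem
  (`gelfond_schneider_holds`, `GelfondSchneiderProofs.lean`).
-/

noncomputable section

namespace Literature.NumberTheory.Transcendental

/-! ### The range `[(mn+m)/(m+n)] ≤ 1`: Gelfond–Schneider -/

/-- **Diaz 1989, Théorème 1, in the range `[(mn+m)/(m+n)] ≤ 1`, PROVED with no measure of linear
independence**: if `u₁, …, u_n` (`n ≥ 1`) and `v₁, …, v_m` (`m ≥ 2`) are each `ℚ`-linearly
independent and `mn + m < 2(m+n)`, then `trdeg_ℚ ℚ(v_k, e^{u_hv_k}) ≥ [(mn+m)/(m+n)]` (`= 1`):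
the Gelfond–Schneider theorem (`DiazMain.one_le_trdeg_adjoin`, for the field `ℚ(v_k, e^{v_ku_h})`,
which is `ℚ(v_k, e^{u_hv_k})` — `gridFieldY_eq_gridField₁_swap`). Covers `m = 2` (all `n ≥ 1`),
`n = 1` (all `m ≥ 2`) and `(m, n) = (3, 2)`.
[cite: Diaz1989, Théorème 1, pp. 1–2]
[cite: Laurent1991, §3.1 p. 212 (Gelfond–Schneider ⟺ t₂ ≥ 1)] -/
theorem Diaz1989_thm1_smallRange (n m : ℕ) (u : Fin n → ℂ) (v : Fin m → ℂ)
    (hu : LinearIndependent ℚ u) (hv : LinearIndependent ℚ v) (hn : 1 ≤ n) (hm : 2 ≤ m)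
    (hsmall : m * n + m < 2 * (m + n)) :
    (((m * n + m) / (m + n) : ℕ) : Cardinal) ≤ Algebra.trdeg ℚ
      ↥(IntermediateField.adjoin ℚ (Set.range v ∪
        Set.range fun p : Fin n × Fin m => Complex.exp (u p.1 * v p.2))) := by
  have hpos : 0 < m + n := by omega
  have h2 : (m * n + m) / (m + n) < 2 := (Nat.div_lt_iff_lt_mul hpos).mpr hsmall
  have hle : (m * n + m) / (m + n) ≤ 1 := by omega
  -- the field `ℚ(v_k, e^{v_ku_h})` of `DiazMain.one_le_trdeg_adjoin m n v u` is `ℚ(v_k, e^{u_hv_k})`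
  have hK : IntermediateField.adjoin ℚ (Set.range v ∪
        Set.range fun p : Fin m × Fin n => Complex.exp (v p.1 * u p.2)) =
      IntermediateField.adjoin ℚ (Set.range v ∪
        Set.range fun p : Fin n × Fin m => Complex.exp (u p.1 * v p.2)) :=
    (gridFieldY_eq_gridField₁_swap u v).symm
  calc (((m * n + m) / (m + n) : ℕ) : Cardinal) ≤ ((1 : ℕ) : Cardinal) := by exact_mod_cast hle
    _ = 1 := Nat.cast_one
    _ ≤ Algebra.trdeg ℚ ↥(IntermediateField.adjoin ℚ (Set.range v ∪
          Set.range fun p : Fin m × Fin n => Complex.exp (v p.1 * u p.2))) :=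
        DiazMain.one_le_trdeg_adjoin m n v u hv hu hm hn
    _ = _ := trdeg_congr hK

/-! ### The range `[(mn+m)/(m+n)] ≤ 2`: Laurent's Remarque 3 -/

/-- **Diaz 1989, Théorème 1, in the range `[(mn+m)/(m+n)] ≤ 2`, PROVED with no measure of linear
independence** (Laurent 1991, Remarque 3, p. 214: "Il en est notamment ainsi en degré de
transcendance 0 ou 1 (i.e. `t_k ≥ 1` ou `2`)"): if `u₁, …, u_n` (`n ≥ 1`) and `v₁, …, v_m`
(`m ≥ 2`) are each `ℚ`-linearly independent and `mn + m < 3(m+n)`, then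
`trdeg_ℚ ℚ(v_k, e^{u_hv_k}) ≥ [(mn+m)/(m+n)]`. The case `[(mn+m)/(m+n)] ≤ 1` is
`Diaz1989_thm1_smallRange` (Gelfond–Schneider); if `2(m+n) ≤ mn + m`, i.e. `m + 2n ≤ mn`, then
LNM 1752, Ch. 13, Theorem 3.1 (ii) (`Laurent2001_thm_3_1_ii_holds`, with `(x, y) = (u, v)`:
`nm ≥ 2n + m ⇒ trdeg ℚ(v_k, e^{u_hv_k}) ≥ 2`) gives the bound `2`.
[cite: Diaz1989, Théorème 1, pp. 1–2]
[cite: Laurent1991, §3.1 Théorème 3 ii) p. 213 and Remarque 3 p. 214]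
[cite: NesterenkoPhilippon2001, Ch. 13 Theorem 3.1 (ii)] -/
theorem Diaz1989_thm1_midRange (n m : ℕ) (u : Fin n → ℂ) (v : Fin m → ℂ)
    (hu : LinearIndependent ℚ u) (hv : LinearIndependent ℚ v) (hn : 1 ≤ n) (hm : 2 ≤ m)
    (hmid : m * n + m < 3 * (m + n)) :
    (((m * n + m) / (m + n) : ℕ) : Cardinal) ≤ Algebra.trdeg ℚ
      ↥(IntermediateField.adjoin ℚ (Set.range v ∪
        Set.range fun p : Fin n × Fin m => Complex.exp (u p.1 * v p.2))) := by
  rcases Nat.lt_or_ge (m * n + m) (2 * (m + n)) with hsmall | hlarge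
  · exact Diaz1989_thm1_smallRange n m u v hu hv hn hm hsmall
  have hpos : 0 < m + n := by omega
  have h3 : (m * n + m) / (m + n) < 3 := (Nat.div_lt_iff_lt_mul hpos).mpr hmid
  have hle : (m * n + m) / (m + n) ≤ 2 := by omega
  have hnm : 2 * n + m ≤ n * m := by
    have := Nat.mul_comm m n
    omega
  -- `gridFieldY u v` of `ExpSmallTrdeg.lean` is `ℚ(v_k, e^{u_hv_k})` by definition
  have h2 : (2 : Cardinal) ≤ Algebra.trdeg ℚ
      ↥(IntermediateField.adjoin ℚ (Set.range v ∪
        Set.range fun p : Fin n × Fin m => Complex.exp (u p.1 * v p.2))) :=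
    Laurent2001_thm_3_1_ii_holds n m u v hn (by omega) hu hv hnm
  calc (((m * n + m) / (m + n) : ℕ) : Cardinal) ≤ ((2 : ℕ) : Cardinal) := by exact_mod_cast hle
    _ = 2 := Nat.cast_ofNat
    _ ≤ _ := h2

/-! ### Reduction of the named fact to the range `3(m+n) ≤ mn + m` -/

/-- **Reduction of `Diaz1989_thm1` to the range `3(m+n) ≤ mn + m`, unconditionally**: since the
range `[(mn+m)/(m+n)] ≤ 2` is settled for all `ℚ`-linearly independent families
(`Diaz1989_thm1_midRange`), Diaz's Théorème 1 follows from its restriction to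
`3(m+n) ≤ mn + m` (`[(mn+m)/(m+n)] ≥ 3`), where a criterion for algebraic independence is needed
(`Diaz1989_thm1_of_mainCriterion`, `Diaz1989_thm1_of_ch8_cor_1_1`).
[cite: Diaz1989, Théorème 1, pp. 1–2]
[cite: Laurent1991, §3.1 Remarque 3, p. 214] -/
theorem Diaz1989_thm1_of_range_three_le
    (H : ∀ (n m : ℕ) (u : Fin n → ℂ) (v : Fin m → ℂ),
      LinearIndependent ℚ u → LinearIndependent ℚ v →
      Diaz1989.MeasureA u ((m * (n + 1) : ℝ) / (2 * m + n)) →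
      Diaz1989.MeasureB v ((m * (n + 1) : ℝ) / (m + 2 * n + 1)) →
      1 ≤ n → 2 ≤ m → 3 * (m + n) ≤ m * n + m →
        (((m * n + m) / (m + n) : ℕ) : Cardinal) ≤ Algebra.trdeg ℚ
          ↥(IntermediateField.adjoin ℚ (Set.range v ∪
            Set.range fun p : Fin n × Fin m => Complex.exp (u p.1 * v p.2)))) :
    Diaz1989_thm1 := by
  intro n m u v hu hv hA hB hn hm
  rcases Nat.lt_or_ge (m * n + m) (3 * (m + n)) with hmid | hlarge
  · exact Diaz1989_thm1_midRange n m u v hu hv hn hm hmid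
  · exact H n m u v hu hv hA hB hn hm hlarge

/-- **`Diaz1989_thm1` is equivalent to its restriction to the range `3(m+n) ≤ mn + m`** (the rest
being proved, `Diaz1989_thm1_midRange`). [cite: Diaz1989, Théorème 1, pp. 1–2]
[cite: Laurent1991, §3.1 Remarque 3, p. 214] -/
theorem Diaz1989_thm1_iff_range_three_le :
    Diaz1989_thm1 ↔
      ∀ (n m : ℕ) (u : Fin n → ℂ) (v : Fin m → ℂ),
        LinearIndependent ℚ u → LinearIndependent ℚ v →
        Diaz1989.MeasureA u ((m * (n + 1) : ℝ) / (2 * m + n)) →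
        Diaz1989.MeasureB v ((m * (n + 1) : ℝ) / (m + 2 * n + 1)) →
        1 ≤ n → 2 ≤ m → 3 * (m + n) ≤ m * n + m →
          (((m * n + m) / (m + n) : ℕ) : Cardinal) ≤ Algebra.trdeg ℚ
            ↥(IntermediateField.adjoin ℚ (Set.range v ∪
              Set.range fun p : Fin n × Fin m => Complex.exp (u p.1 * v p.2))) :=
  ⟨fun h n m u v hu hv hA hB hn hm _ => h n m u v hu hv hA hB hn hm,
    Diaz1989_thm1_of_range_three_le⟩

/-- Numerology of the remaining range: `3(m+n) ≤ mn + m`, i.e. `m(n − 2) ≥ 3n`, forces `n ≥ 3`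
and `m ≥ 4` (extreme cases `(m, n) = (9, 3), (6, 4), (5, 5), (4, 8)`). [folklore] -/
theorem Diaz1989_thm1.largeRange_bounds {m n : ℕ} (hm : 2 ≤ m) (h : 3 * (m + n) ≤ m * n + m) :
    3 ≤ n ∧ 4 ≤ m := by
  constructor
  · by_contra hn
    have hn2 : n ≤ 2 := by omega
    interval_cases n <;> omega
  · by_contra hm4
    have hm3 : m ≤ 3 := by omega
    have := Nat.mul_le_mul_right n hm3
    omega

end Literature.NumberTheory.Transcendental

end
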